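import Mathlib
import HarnessLib
import Literature.Analysis.FluidPDE.TypeIAncientMild
import Literature.Analysis.FluidPDE.KatoLocalBoundedPicard
import Summits.NavierStokesRegularity.NavierStokesRegularity.Theorems.QuarterLogPincerTruncationEdgeOseenStability

/-!
# Route `QuarterLogPincer`, crux `TypeIQuantSubcubicExp` (stmt-NavierStokesRegularity-24077), line `quiet_collar` — towards QP3
# `stub_forcedTwoNormShadowing`: `L^∞` STABILITY OF AN OSEEN-MILD FIELD AROUND A REFERENCE WITH A MILD DEFECT (polynomial loss)

QP3 `ForcedTwoNormShadowing` of ns-idea-7 g9's line `quiet_collar` v1.1 (`Theorems/QuarterLogPincerQuietCollarDefs.lean`) compares a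
Tao-frame solution `u` with a REFERENCE `V` that is NOT a solution: `V(t) = e^{tΔ}V(0) − B₀(V,V)(t) + D(t)` with a small MILD DEFECT
`D` (`mildDefect`).  This file is the `L^∞` half of that statement as kernel theorems: the `…TruncationEdgeOseenStability` chain of
typer g35 (two Oseen-mild fields: step / bounded drift / Type-I dyadic blocks) GENERALISED TO A REFERENCE WITH DEFECT — the second
field `v` satisfies the Oseen identity from the base time only up to an additive field `D` bounded by `η_D`:

* `exists_quasiMild_sub_step` — ONE SHORT STEP: `u` Oseen-mild from `s`, `v = e^{(t−s)Δ}v(s) − B_s(v,v) + D` with `‖D‖ ≤ η_D` on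
  `(s,T]`, both bounded by `U`, `‖u(s) − v(s)‖ ≤ η`, `8CU√(T−s) ≤ 1` ⇒ `sup_{[s,T]}‖u − v‖ ≤ 2(η + η_D)`.
* `exists_quasiMild_sub_le_two_pow` — BOUNDED DRIFT on `[a,b]`, `v` quasi-mild from EVERY base time with defects `D s` bounded by
  `η_D`: `‖u − v‖ ≤ 2^N (η + 2η_D)`, `N = ⌈64C²U²(b−a)⌉`.
* `exists_quasiMild_sub_le_of_typeI` — TYPE-I DRIFT `M/√(T₀−t)` on `[a,T]`, `T < T₀`:
  `‖u(t) − v(t)‖_∞ ≤ (η + 2η_D)·(2(T₀−a)/(T₀−t))^{m+1}`, `m = ⌈64C²M²⌉` — POLYNOMIAL loss, with the defects paid once per block.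

Tools: `exists_norm_oseenDuhamel_le_mul`, `oseenDuhamel_self_sub_self` (`KatoLocalBoundedPicard`), `heatFlow_of_pos`,
`UnboundedOperators.heatExtension_sub_of_bound`, `UnboundedOperators.norm_heatExtension_le`, `exists_nat_pow_near`.
HONEST FRAME: perturbation theory of ONE hypothetical Oseen-mild field around a reference; nothing here bears on 24077, the DSS
wall W7 or Navier–Stokes regularity (OPEN / not proved).  Helper of the pub-ns-dss typer (g36), `--supports 24077`.
-/

noncomputable section

set_option linter.dupNamespace false

namespace Summit.NavierStokesRegularity.NavierStokesRegularity.Cruxes.TypeIQuantSubcubicExp.QuietCollar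

open MeasureTheory Set Function Filter Real Metric
open scoped ENNReal NNReal Topology
open Literature.Analysis Literature.Analysis.FluidPDE
open Summit.NavierStokesRegularity.NavierStokesRegularity.Theorems.QuarterLogPincerTruncationEdge
  (continuous_slice_of_continuousOn_slab aestronglyMeasurable_of_continuousOn_slab)

/-! ## One short step -/

/-- **One short step around a reference with defect.**  With the universal `C` of `exists_norm_oseenDuhamel_le_mul`: `u`, `v`
jointly continuous on `[s,T] × ℝ³`, `u` Oseen-mild from `s`, `v(t) = e^{(t−s)Δ}v(s) − B_s(v,v)(t) + D(t)` with `‖D(t,x)‖ ≤ η_D` on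
`(s,T]`, both bounded by `U > 0`, `‖u(s,·) − v(s,·)‖ ≤ η`, and `8CU√(T−s) ≤ 1` ⇒ `‖u(t,x) − v(t,x)‖ ≤ 2(η + η_D)` on `[s,T]`
(`sup‖w‖ ≤ η + η_D + ½ sup‖w‖`, started from the a-priori bound `2U`). [folklore; KNSS 2009 §4 p. 8] -/
theorem exists_quasiMild_sub_step :
    ∃ C : ℝ, 0 < C ∧ ∀ {u v D : ℝ → EuclideanSpace ℝ (Fin 3) → EuclideanSpace ℝ (Fin 3)} {s T U η ηD : ℝ},
      s < T → ContinuousOn (uncurry u) (Icc s T ×ˢ univ) → ContinuousOn (uncurry v) (Icc s T ×ˢ univ) →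
      (∀ t ∈ Ioc s T, ∀ x, u t x = heatFlow (u s) (t - s) x - oseenDuhamel 1 s u u t x) →
      (∀ t ∈ Ioc s T, ∀ x, v t x = heatFlow (v s) (t - s) x - oseenDuhamel 1 s v v t x + D t x) →
      (∀ t ∈ Ioc s T, ∀ x, ‖D t x‖ ≤ ηD) →
      0 < U → (∀ τ ∈ Icc s T, ∀ y, ‖u τ y‖ ≤ U) → (∀ τ ∈ Icc s T, ∀ y, ‖v τ y‖ ≤ U) →
      (∀ y, ‖u s y - v s y‖ ≤ η) → 8 * C * U * Real.sqrt (T - s) ≤ 1 →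
      ∀ t ∈ Icc s T, ∀ x, ‖u t x - v t x‖ ≤ 2 * (η + ηD) := by
  obtain ⟨C, hC, hB⟩ := exists_norm_oseenDuhamel_le_mul (E := EuclideanSpace ℝ (Fin 3))
  refine ⟨C, hC, ?_⟩
  intro u v D s T U η ηD hsT hcu hcv hmu hmv hD hU huU hvU hη hshort
  have hη0 : 0 ≤ η := (norm_nonneg _).trans (hη 0)
  have hηD0 : 0 ≤ ηD := (norm_nonneg _).trans (hD T ⟨hsT, le_rfl⟩ 0)
  have hmu' := aestronglyMeasurable_of_continuousOn_slab hcu le_rfl le_rfl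
  have hmv' := aestronglyMeasurable_of_continuousOn_slab hcv le_rfl le_rfl
  have huU' : ∀ τ ∈ Ioo s T, ∀ y, ‖u τ y‖ ≤ U := fun τ hτ y => huU τ ⟨hτ.1.le, hτ.2.le⟩ y
  have hvU' : ∀ τ ∈ Ioo s T, ∀ y, ‖v τ y‖ ≤ U := fun τ hτ y => hvU τ ⟨hτ.1.le, hτ.2.le⟩ y
  -- the improvement step `K ↦ η + η_D + K/2`
  have himp : ∀ K : ℝ, 0 ≤ K → (∀ τ ∈ Icc s T, ∀ y, ‖u τ y - v τ y‖ ≤ K) →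
      ∀ t ∈ Icc s T, ∀ x, ‖u t x - v t x‖ ≤ η + ηD + K / 2 := by
    intro K hK hwK t ht x
    rcases eq_or_lt_of_le ht.1 with h | h
    · rw [← h]
      exact (hη x).trans (by linarith)
    have htT : t ≤ T := ht.2
    have hts : 0 < t - s := sub_pos.2 h
    have hheat : ‖heatFlow (u s) (t - s) x - heatFlow (v s) (t - s) x‖ ≤ η := by
      rw [heatFlow_of_pos _ hts, heatFlow_of_pos _ hts,
        ← UnboundedOperators.heatExtension_sub_of_bound
          (continuous_slice_of_continuousOn_slab hcu (left_mem_Icc.2 hsT.le))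
          (continuous_slice_of_continuousOn_slab hcv (left_mem_Icc.2 hsT.le))
          (fun z => huU s (left_mem_Icc.2 hsT.le) z) (fun z => hvU s (left_mem_Icc.2 hsT.le) z) hts x]
      exact UnboundedOperators.norm_heatExtension_le hη hts x
    have hwK' : ∀ τ ∈ Ioo s t, ∀ y, ‖u τ y - v τ y‖ ≤ K := fun τ hτ y =>
      hwK τ ⟨hτ.1.le, hτ.2.le.trans htT⟩ y
    have huUt : ∀ τ ∈ Ioo s t, ∀ y, ‖u τ y‖ ≤ U := fun τ hτ y => huU τ ⟨hτ.1.le, hτ.2.le.trans htT⟩ y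
    have hvUt : ∀ τ ∈ Ioo s t, ∀ y, ‖v τ y‖ ≤ U := fun τ hτ y => hvU τ ⟨hτ.1.le, hτ.2.le.trans htT⟩ y
    have hsplit := oseenDuhamel_self_sub_self (ν := (1:ℝ)) one_pos hmu' hmv' huU' hvU' h htT x
    have h1 : ‖oseenDuhamel 1 s (fun τ y => u τ y - v τ y) u t x‖ ≤ C * K * U * (2 * Real.sqrt (t - s)) := by
      have := hB one_pos h hK hU.le hwK' huUt x
      simpa only [Real.one_rpow, mul_one] using this
    have h2 : ‖oseenDuhamel 1 s v (fun τ y => u τ y - v τ y) t x‖ ≤ C * U * K * (2 * Real.sqrt (t - s)) := by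
      have := hB one_pos h hU.le hK hvUt hwK' x
      simpa only [Real.one_rpow, mul_one] using this
    have hsqrt : Real.sqrt (t - s) ≤ Real.sqrt (T - s) := Real.sqrt_le_sqrt (by linarith)
    have hDuh : ‖oseenDuhamel 1 s u u t x - oseenDuhamel 1 s v v t x‖ ≤ K / 2 := by
      rw [hsplit]
      refine (norm_add_le _ _).trans ?_
      have h3 : C * K * U * (2 * Real.sqrt (t - s)) + C * U * K * (2 * Real.sqrt (t - s))
          = (8 * C * U * Real.sqrt (t - s)) * K / 2 := by ring
      refine (add_le_add h1 h2).trans ?_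
      rw [h3]
      have h4 : 8 * C * U * Real.sqrt (t - s) ≤ 1 :=
        (mul_le_mul_of_nonneg_left hsqrt (by positivity)).trans hshort
      have h5 : (8 * C * U * Real.sqrt (t - s)) * K ≤ 1 * K := mul_le_mul_of_nonneg_right h4 hK
      linarith
    have hDt : ‖D t x‖ ≤ ηD := hD t ⟨h, htT⟩ x
    rw [hmu t ⟨h, htT⟩ x, hmv t ⟨h, htT⟩ x]
    have e : heatFlow (u s) (t - s) x - oseenDuhamel 1 s u u t x -
        (heatFlow (v s) (t - s) x - oseenDuhamel 1 s v v t x + D t x) =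
        (heatFlow (u s) (t - s) x - heatFlow (v s) (t - s) x) -
          (oseenDuhamel 1 s u u t x - oseenDuhamel 1 s v v t x) - D t x := by abel
    rw [e]
    calc ‖(heatFlow (u s) (t - s) x - heatFlow (v s) (t - s) x) -
          (oseenDuhamel 1 s u u t x - oseenDuhamel 1 s v v t x) - D t x‖
        ≤ ‖(heatFlow (u s) (t - s) x - heatFlow (v s) (t - s) x) -
          (oseenDuhamel 1 s u u t x - oseenDuhamel 1 s v v t x)‖ + ‖D t x‖ := norm_sub_le _ _
      _ ≤ (η + K / 2) + ηD := add_le_add ((norm_sub_le _ _).trans (add_le_add hheat hDuh)) hDt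
      _ = η + ηD + K / 2 := by ring
  -- iterate from the a-priori bound `2U`
  have hiter : ∀ n : ℕ, ∀ τ ∈ Icc s T, ∀ y, ‖u τ y - v τ y‖ ≤ 2 * (η + ηD) + 2 * U * (1 / 2 : ℝ) ^ n := by
    intro n
    induction n with
    | zero =>
      intro τ hτ y
      have : ‖u τ y - v τ y‖ ≤ 2 * U :=
        (norm_sub_le _ _).trans (by linarith [huU τ hτ y, hvU τ hτ y])
      simp only [pow_zero, mul_one]
      linarith
    | succ n ih =>
      intro τ hτ y
      have hK : 0 ≤ 2 * (η + ηD) + 2 * U * (1 / 2 : ℝ) ^ n := by positivity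
      have := himp _ hK ih τ hτ y
      have e : η + ηD + (2 * (η + ηD) + 2 * U * (1 / 2 : ℝ) ^ n) / 2 =
          2 * (η + ηD) + 2 * U * (1 / 2 : ℝ) ^ (n + 1) := by
        rw [pow_succ]; ring
      linarith
  intro t ht x
  have hlim : Tendsto (fun n : ℕ => 2 * (η + ηD) + 2 * U * (1 / 2 : ℝ) ^ n) atTop (𝓝 (2 * (η + ηD))) := by
    have : Tendsto (fun n : ℕ => (1 / 2 : ℝ) ^ n) atTop (𝓝 0) :=
      tendsto_pow_atTop_nhds_zero_of_lt_one (by norm_num) (by norm_num)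
    simpa using (this.const_mul (2 * U)).const_add (2 * (η + ηD))
  exact ge_of_tendsto' hlim fun n => hiter n t ht x

/-! ## Bounded drift -/

/-- **Bounded drift, reference with defects from every base time: amplification `2^N (η + 2η_D)`, `N = ⌈64C²U²(b−a)⌉`.**
`u` Oseen-mild between every pair of times of `[a,b]`; `v(t) = e^{(t−s)Δ}v(s) − B_s(v,v)(t) + D_s(t)` for every base time
`a ≤ s < t ≤ b` with `‖D_s(t,x)‖ ≤ η_D`; both bounded by `U > 0`; `‖u(a,·) − v(a,·)‖ ≤ η`. [folklore] -/
theorem exists_quasiMild_sub_le_two_pow :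
    ∃ C : ℝ, 0 < C ∧ ∀ {u v : ℝ → EuclideanSpace ℝ (Fin 3) → EuclideanSpace ℝ (Fin 3)}
      {D : ℝ → ℝ → EuclideanSpace ℝ (Fin 3) → EuclideanSpace ℝ (Fin 3)} {a b U η ηD : ℝ},
      a ≤ b → ContinuousOn (uncurry u) (Icc a b ×ˢ univ) → ContinuousOn (uncurry v) (Icc a b ×ˢ univ) →
      (∀ s t : ℝ, a ≤ s → s < t → t ≤ b → ∀ x, u t x = heatFlow (u s) (t - s) x - oseenDuhamel 1 s u u t x) →
      (∀ s t : ℝ, a ≤ s → s < t → t ≤ b → ∀ x,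
        v t x = heatFlow (v s) (t - s) x - oseenDuhamel 1 s v v t x + D s t x) →
      (∀ s t : ℝ, a ≤ s → s < t → t ≤ b → ∀ x, ‖D s t x‖ ≤ ηD) → 0 ≤ ηD →
      0 < U → (∀ τ ∈ Icc a b, ∀ y, ‖u τ y‖ ≤ U) → (∀ τ ∈ Icc a b, ∀ y, ‖v τ y‖ ≤ U) →
      (∀ y, ‖u a y - v a y‖ ≤ η) →
      ∀ t ∈ Icc a b, ∀ x, ‖u t x - v t x‖ ≤ 2 ^ ⌈64 * C ^ 2 * U ^ 2 * (b - a)⌉₊ * (η + 2 * ηD) := by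
  obtain ⟨C, hC, hstep⟩ := exists_quasiMild_sub_step
  refine ⟨C, hC, ?_⟩
  intro u v D a b U η ηD hab hcu hcv hmu hmv hD hηD hU huU hvU hη
  have hη0 : 0 ≤ η := (norm_nonneg _).trans (hη 0)
  set h₀ : ℝ := 1 / (64 * C ^ 2 * U ^ 2) with hh₀
  have hh₀pos : 0 < h₀ := by positivity
  have hsqrt_h₀ : Real.sqrt h₀ = 1 / (8 * C * U) := by
    rw [show h₀ = (1 / (8 * C * U)) ^ 2 by rw [hh₀]; field_simp; ring]
    exact Real.sqrt_sq (by positivity)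
  -- induction over the steps: error `e_k ≤ 2^k (η + 2η_D) − 2η_D`
  have hind : ∀ k : ℕ, ∀ t ∈ Icc a b, t ≤ a + k * h₀ → ∀ x,
      ‖u t x - v t x‖ ≤ 2 ^ k * (η + 2 * ηD) - 2 * ηD := by
    intro k
    induction k with
    | zero =>
      intro t ht htk x
      have hta : t = a := le_antisymm (by simpa using htk) ht.1
      rw [hta, pow_zero, one_mul]
      linarith [hη x]
    | succ k ih =>
      intro t ht htk x
      by_cases hle : t ≤ a + k * h₀
      · refine (ih t ht hle x).trans ?_
        rw [pow_succ]
        nlinarith [pow_pos (show (0:ℝ) < 2 by norm_num) k]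
      push Not at hle
      set s : ℝ := a + k * h₀ with hs
      have has : a ≤ s := by rw [hs]; nlinarith [hh₀pos.le, (k.cast_nonneg : (0:ℝ) ≤ k)]
      have hst : s < t := hle
      have hsb : s ≤ b := hst.le.trans ht.2
      set T : ℝ := min b (s + h₀) with hT
      have hsT : s < T := lt_min (lt_of_lt_of_le hst ht.2) (by linarith)
      have hTb : T ≤ b := min_le_left _ _
      have htT : t ≤ T := le_min ht.2 (by
        have : ((k + 1 : ℕ) : ℝ) * h₀ = k * h₀ + h₀ := by push_cast; ring
        linarith)
      have hsub : Icc s T ×ˢ (univ : Set (EuclideanSpace ℝ (Fin 3))) ⊆ Icc a b ×ˢ univ :=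
        prod_mono (Icc_subset_Icc has hTb) subset_rfl
      have hpos : 0 ≤ 2 ^ k * (η + 2 * ηD) - 2 * ηD := by
        have h1 : (1:ℝ) ≤ 2 ^ k := one_le_pow₀ (by norm_num)
        nlinarith
      have hηs : ∀ y, ‖u s y - v s y‖ ≤ 2 ^ k * (η + 2 * ηD) - 2 * ηD := fun y => ih s ⟨has, hsb⟩ le_rfl y
      have hshort : 8 * C * U * Real.sqrt (T - s) ≤ 1 := by
        have h1 : Real.sqrt (T - s) ≤ Real.sqrt h₀ := Real.sqrt_le_sqrt (by linarith [min_le_right b (s + h₀)])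
        calc 8 * C * U * Real.sqrt (T - s) ≤ 8 * C * U * Real.sqrt h₀ :=
              mul_le_mul_of_nonneg_left h1 (by positivity)
          _ = 1 := by rw [hsqrt_h₀]; field_simp
      have := hstep hsT (hcu.mono hsub) (hcv.mono hsub)
        (fun t' ht' x' => hmu s t' has ht'.1 (ht'.2.trans hTb) x')
        (fun t' ht' x' => hmv s t' has ht'.1 (ht'.2.trans hTb) x')
        (fun t' ht' x' => hD s t' has ht'.1 (ht'.2.trans hTb) x')
        hU (fun τ hτ y => huU τ ⟨has.trans hτ.1, hτ.2.trans hTb⟩ y)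
        (fun τ hτ y => hvU τ ⟨has.trans hτ.1, hτ.2.trans hTb⟩ y) hηs hshort t ⟨hst.le, htT⟩ x
      rw [pow_succ]
      linarith
  intro t ht x
  have hN : (b - a) / h₀ ≤ (⌈64 * C ^ 2 * U ^ 2 * (b - a)⌉₊ : ℝ) := by
    have : (b - a) / h₀ = 64 * C ^ 2 * U ^ 2 * (b - a) := by rw [hh₀]; field_simp
    rw [this]
    exact Nat.le_ceil _
  have hle : b - a ≤ (⌈64 * C ^ 2 * U ^ 2 * (b - a)⌉₊ : ℝ) * h₀ := by
    rw [div_le_iff₀ hh₀pos] at hN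
    exact hN
  have := hind _ t ht (by linarith [ht.2]) x
  linarith

/-! ## Type-I drift: dyadic blocks, polynomial amplification -/

/-- **`L^∞` STABILITY AROUND A REFERENCE WITH DEFECT UNDER A TYPE-I DRIFT — POLYNOMIAL LOSS.**  With the universal `C` and
`m := ⌈64C²M²⌉`: `u`, `v` jointly continuous on `[a,T] × ℝ³`, `u` Oseen-mild between every pair of times, `v` quasi-mild from every
base time with defects bounded by `η_D`, both obeying the Type-I bound `M/√(T₀−t)` (`T < T₀`, `M > 0`), `‖u(a,·) − v(a,·)‖ ≤ η` ⇒
`‖u(t,x) − v(t,x)‖ ≤ (η + 2η_D)·(2(T₀−a)/(T₀−t))^{m+1}` on `[a,T]` (per dyadic block a factor `2^m` and one payment `2η_D`;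
`j+1 ≤ 2^{j+1}` absorbs the number of payments into one extra power). [folklore; KNSS 2009 §4 p. 8] -/
theorem exists_quasiMild_sub_le_of_typeI :
    ∃ C : ℝ, 0 < C ∧ ∀ {u v : ℝ → EuclideanSpace ℝ (Fin 3) → EuclideanSpace ℝ (Fin 3)}
      {D : ℝ → ℝ → EuclideanSpace ℝ (Fin 3) → EuclideanSpace ℝ (Fin 3)} {a T T₀ M η ηD : ℝ},
      a ≤ T → T < T₀ → ContinuousOn (uncurry u) (Icc a T ×ˢ univ) → ContinuousOn (uncurry v) (Icc a T ×ˢ univ) →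
      (∀ s t : ℝ, a ≤ s → s < t → t ≤ T → ∀ x, u t x = heatFlow (u s) (t - s) x - oseenDuhamel 1 s u u t x) →
      (∀ s t : ℝ, a ≤ s → s < t → t ≤ T → ∀ x,
        v t x = heatFlow (v s) (t - s) x - oseenDuhamel 1 s v v t x + D s t x) →
      (∀ s t : ℝ, a ≤ s → s < t → t ≤ T → ∀ x, ‖D s t x‖ ≤ ηD) → 0 ≤ ηD →
      0 < M → (∀ τ ∈ Icc a T, ∀ y, ‖u τ y‖ ≤ M / Real.sqrt (T₀ - τ)) →
      (∀ τ ∈ Icc a T, ∀ y, ‖v τ y‖ ≤ M / Real.sqrt (T₀ - τ)) →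
      (∀ y, ‖u a y - v a y‖ ≤ η) →
      ∀ t ∈ Icc a T, ∀ x,
        ‖u t x - v t x‖ ≤ (η + 2 * ηD) * (2 * (T₀ - a) / (T₀ - t)) ^ (⌈64 * C ^ 2 * M ^ 2⌉₊ + 1) := by
  obtain ⟨C, hC, hA⟩ := exists_quasiMild_sub_le_two_pow
  refine ⟨C, hC, ?_⟩
  intro u v D a T T₀ M η ηD haT hTT₀ hcu hcv hmu hmv hD hηD hM huM hvM hη
  have hη0 : 0 ≤ η := (norm_nonneg _).trans (hη 0)
  have haT₀ : a < T₀ := lt_of_le_of_lt haT hTT₀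
  set m : ℕ := ⌈64 * C ^ 2 * M ^ 2⌉₊ with hm
  set b : ℕ → ℝ := fun j => T₀ - (T₀ - a) / 2 ^ j with hb
  have hb0 : b 0 = a := by simp [hb]
  have hb_lt : ∀ j, b j < T₀ := fun j => by
    simp only [hb]; have : 0 < (T₀ - a) / 2 ^ j := by positivity
    linarith
  have hb_ge : ∀ j, a ≤ b j := fun j => by
    simp only [hb]
    have h2 : (1:ℝ) ≤ 2 ^ j := one_le_pow₀ (by norm_num)
    have : (T₀ - a) / 2 ^ j ≤ T₀ - a := div_le_self (by linarith) h2
    linarith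
  have hb_succ : ∀ j, b (j + 1) - b j = (T₀ - a) / 2 ^ (j + 1) := fun j => by
    simp only [hb, pow_succ]; field_simp; ring
  have hb_gap : ∀ j, T₀ - b (j + 1) = (T₀ - a) / 2 ^ (j + 1) := fun j => by simp only [hb]; ring
  -- induction over blocks: `E_j ≤ 2^{mj} (η + 2 j η_D)`
  have hind : ∀ j : ℕ, ∀ t ∈ Icc a T, t ≤ b j → ∀ x,
      ‖u t x - v t x‖ ≤ 2 ^ (m * j) * (η + 2 * j * ηD) := by
    intro j
    induction j with
    | zero =>
      intro t ht htj x
      have hta : t = a := le_antisymm (by rw [hb0] at htj; exact htj) ht.1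
      rw [hta]
      simp only [mul_zero, pow_zero, one_mul, Nat.cast_zero, zero_mul, add_zero]
      exact hη x
    | succ j ih =>
      intro t ht htj x
      have hmono : (2:ℝ) ^ (m * j) * (η + 2 * j * ηD) ≤ 2 ^ (m * (j + 1)) * (η + 2 * ((j + 1 : ℕ) : ℝ) * ηD) := by
        have h1 : (2:ℝ) ^ (m * j) ≤ 2 ^ (m * (j + 1)) := pow_le_pow_right₀ (by norm_num) (by nlinarith)
        have h2 : η + 2 * j * ηD ≤ η + 2 * ((j + 1 : ℕ) : ℝ) * ηD := by
          push_cast; nlinarith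
        exact mul_le_mul h1 h2 (by positivity) (by positivity)
      by_cases hle : t ≤ b j
      · exact (ih t ht hle x).trans hmono
      push Not at hle
      set a' : ℝ := b j with ha'
      set b' : ℝ := min T (b (j + 1)) with hb'
      have ha'b' : a' ≤ b' := le_min (hle.le.trans ht.2)
        (by linarith [hb_succ j, show 0 < (T₀ - a) / 2 ^ (j+1) by positivity])
      have haa' : a ≤ a' := hb_ge j
      have hb'T : b' ≤ T := min_le_left _ _
      have htb' : t ≤ b' := le_min ht.2 htj
      have hgap : 0 < T₀ - b (j + 1) := by linarith [hb_lt (j + 1)]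
      set U : ℝ := M / Real.sqrt (T₀ - b (j + 1)) with hU
      have hUpos : 0 < U := div_pos hM (Real.sqrt_pos.2 hgap)
      have hsub : Icc a' b' ×ˢ (univ : Set (EuclideanSpace ℝ (Fin 3))) ⊆ Icc a T ×ˢ univ :=
        prod_mono (Icc_subset_Icc haa' hb'T) subset_rfl
      have hdom : ∀ τ ∈ Icc a' b', M / Real.sqrt (T₀ - τ) ≤ U := by
        intro τ hτ
        have h1 : T₀ - b (j + 1) ≤ T₀ - τ := by linarith [hτ.2, min_le_right T (b (j + 1))]
        exact div_le_div_of_nonneg_left hM.le (Real.sqrt_pos.2 hgap) (Real.sqrt_le_sqrt h1)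
      have hηj : ∀ y, ‖u a' y - v a' y‖ ≤ 2 ^ (m * j) * (η + 2 * j * ηD) := fun y =>
        ih a' ⟨haa', hle.le.trans ht.2⟩ le_rfl y
      have hres := hA ha'b' (hcu.mono hsub) (hcv.mono hsub)
        (fun s t' hs hst' ht' x' => hmu s t' (haa'.trans hs) hst' (ht'.trans hb'T) x')
        (fun s t' hs hst' ht' x' => hmv s t' (haa'.trans hs) hst' (ht'.trans hb'T) x')
        (fun s t' hs hst' ht' x' => hD s t' (haa'.trans hs) hst' (ht'.trans hb'T) x') hηD
        hUpos (fun τ hτ y => (huM τ ⟨haa'.trans hτ.1, hτ.2.trans hb'T⟩ y).trans (hdom τ hτ))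
        (fun τ hτ y => (hvM τ ⟨haa'.trans hτ.1, hτ.2.trans hb'T⟩ y).trans (hdom τ hτ))
        hηj t ⟨hle.le, htb'⟩ x
      have hN : ⌈64 * C ^ 2 * U ^ 2 * (b' - a')⌉₊ ≤ m := by
        refine Nat.ceil_mono ?_
        have hlen : b' - a' ≤ b (j + 1) - b j := by
          simp only [hb', ha']; linarith [min_le_right T (b (j + 1))]
        have hU2 : U ^ 2 = M ^ 2 / (T₀ - b (j + 1)) := by
          rw [hU, div_pow, Real.sq_sqrt hgap.le]
        have hkey : U ^ 2 * (b (j + 1) - b j) = M ^ 2 := by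
          have hne : T₀ - a ≠ 0 := by linarith
          rw [hU2, hb_succ, hb_gap]; field_simp
        calc 64 * C ^ 2 * U ^ 2 * (b' - a') ≤ 64 * C ^ 2 * U ^ 2 * (b (j + 1) - b j) :=
              mul_le_mul_of_nonneg_left hlen (by positivity)
          _ = 64 * C ^ 2 * M ^ 2 := by rw [mul_assoc (64 * C ^ 2), hkey]
      have hin0 : 0 ≤ η + 2 * j * ηD := by positivity
      calc ‖u t x - v t x‖ ≤ 2 ^ ⌈64 * C ^ 2 * U ^ 2 * (b' - a')⌉₊ * (2 ^ (m * j) * (η + 2 * j * ηD) + 2 * ηD) := hres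
        _ ≤ 2 ^ m * (2 ^ (m * j) * (η + 2 * j * ηD) + 2 * ηD) :=
            mul_le_mul_of_nonneg_right (pow_le_pow_right₀ (by norm_num) hN) (by positivity)
        _ ≤ 2 ^ m * (2 ^ (m * j) * (η + 2 * j * ηD) + 2 ^ (m * j) * (2 * ηD)) := by
            have h1 : (1:ℝ) ≤ 2 ^ (m * j) := one_le_pow₀ (by norm_num)
            have h2 : 2 * ηD ≤ 2 ^ (m * j) * (2 * ηD) := by nlinarith
            exact mul_le_mul_of_nonneg_left (by linarith) (by positivity)
        _ = 2 ^ (m * (j + 1)) * (η + 2 * ((j + 1 : ℕ) : ℝ) * ηD) := by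
            push_cast
            rw [show m * (j + 1) = m + m * j by ring, pow_add]
            ring
  -- locate `t` in a dyadic block
  intro t ht x
  have hgap_t : 0 < T₀ - t := by linarith [ht.2]
  set X : ℝ := (T₀ - a) / (T₀ - t) with hX
  have hX1 : 1 ≤ X := by rw [hX, le_div_iff₀ hgap_t]; linarith [ht.1]
  obtain ⟨n, hn1, hn2⟩ := exists_nat_pow_near hX1 (show (1:ℝ) < 2 by norm_num)
  have htb : t ≤ b (n + 1) := by
    simp only [hb]
    have : (T₀ - a) / 2 ^ (n + 1) ≤ T₀ - t := by
      rw [div_le_iff₀ (by positivity)]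
      have := hn2.le
      rw [hX, div_le_iff₀ hgap_t] at this
      linarith
    linarith
  refine (hind (n + 1) t ht htb x).trans ?_
  have h2X : (2:ℝ) ^ (n + 1) ≤ 2 * X := by rw [pow_succ]; linarith
  have hXeq : 2 * X = 2 * (T₀ - a) / (T₀ - t) := by rw [hX]; ring
  -- `n + 1 ≤ 2^{n+1} ≤ 2X`, so `η + 2(n+1)η_D ≤ 2X (η + 2η_D)`
  have hn_le : ((n + 1 : ℕ) : ℝ) ≤ (2:ℝ) ^ (n + 1) := by
    have := Nat.lt_two_pow_self (n := n + 1)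
    exact_mod_cast this.le
  have hX0 : 0 ≤ X := by linarith
  have hsum : η + 2 * ((n + 1 : ℕ) : ℝ) * ηD ≤ 2 * X * (η + 2 * ηD) := by
    have h1 : ((n + 1 : ℕ) : ℝ) ≤ 2 * X := hn_le.trans h2X
    nlinarith
  rw [← hXeq]
  calc (2:ℝ) ^ (m * (n + 1)) * (η + 2 * ((n + 1 : ℕ) : ℝ) * ηD)
      = ((2:ℝ) ^ (n + 1)) ^ m * (η + 2 * ((n + 1 : ℕ) : ℝ) * ηD) := by rw [← pow_mul, Nat.mul_comm]
    _ ≤ (2 * X) ^ m * (2 * X * (η + 2 * ηD)) :=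
        mul_le_mul (pow_le_pow_left₀ (by positivity) h2X m) hsum (by positivity) (by positivity)
    _ = (η + 2 * ηD) * (2 * X) ^ (m + 1) := by rw [pow_succ]; ring

end Summit.NavierStokesRegularity.NavierStokesRegularity.Cruxes.TypeIQuantSubcubicExp.QuietCollar

end
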